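import Mathlib
import Literature.NumberTheory.LFunctions.Zhang2022.TypedSection10A
import HarnessLib

/-!
# Zhang (2022) §10, the "direct calculation" asymptotics of p. 57 (`Z22:§10.u023`, `Z22:§10.u024`),
# kernel-checked with the actual shifts of (2.13)

Topic `Literature/NumberTheory/LFunctions/Zhang2022` (Landau–Siegel audit tree; verdict-neutral).
Y. Zhang, *Discrete mean estimates and the Landau–Siegel zero*, arXiv:2211.02515v1 (2022)
[Zhang2022LandauSiegel] — **an unrefereed manuscript under adjudication**; this theorem-only file
PROVES two proof-internal displays of its §10 (campaign siegel-zhang, plan/DAG.tsv nodes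
`Z22:§10.u023`, `Z22:§10.u024`; the definitions `Z22:§10.u025`–`u030` are the tree's
`Section10Defs.yy11 … yy23`) as theorems about the banked skeleton objects `Skeleton.betaJ`,
`Skeleton.fraky1`, `Skeleton.fraky2`, and asserts nothing about its Theorems 1–2.

* `Z22:§10.u023` [Z22 p.57, tex L2857]: "By direct calculation, for `0 ≤ z ≤ 1` we have
  `β_j log P^{z−0.5} = πij(z − 0.5) + O(𝓛⁻⁸)`, `β_j log P^{0.504−z} = πij(0.504 − z) + O(𝓛⁻⁸)`" —
  `norm_betaJ_mul_log_rpow_sub_le` (`j ∈ {1,2,3}`, any real exponent `w`: error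
  `≤ 5π²|c′||w|𝓛⁻⁸`), and the typed node DISCHARGED: `Typed.Sec10A.step10u023_holds :
  Typed.Sec10A.Step10u023 c′` (L3-t1's statement in `TypedSection10A`, `C = 5π²|c′|`, `D ≥ 3`).
* `Z22:§10.u024` [Z22 p.57, tex L2860]: "`𝔶₁ⱼ(P^z) = 𝔶𝔶₁ⱼ(z) + O(𝓛⁻⁸)`, `𝔶₂ⱼ(P^z) = 𝔶𝔶₂ⱼ(z) + O(𝓛⁻⁸)`"
  with the six printed `𝔶𝔶_{μj}` [tex L2864–2881] = the tree's `yy11, yy21, yy12, yy22, yy13, yy23`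
  — the shift-generic `norm_fraky1_rpow_sub_yy1F_le_of`, `norm_fraky2_rpow_sub_yy2F_le_of`
  (`0 ≤ z ≤ 1`, `𝓛 ≥ 1`: error `≤ (10π²|c′| + 30π³|c′| + 75π⁴c′²)𝓛⁻⁸`), and the typed node
  DISCHARGED: `Typed.Sec10A.step10u024_holds : Typed.Sec10A.Step10u024 c′` (same `C`, `D ≥ 3`).

The shifts are the ACTUAL `β_j` of (2.13) with their `c′α𝓛` corrections (`Skeleton.beta1/2/3`,
`betaJ` read modulo 3 as in §8, so `(β_{j+1}, β_{j+2}) = (β₂,β₃), (β₃,β₁), (β₁,β₂)`):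
`β_k = ikα(1 + ε_k)` with `ε₁ = −5c′α𝓛`, `ε₂ = c′α𝓛`, `ε₃ = −c′α𝓛` (`beta1/2/3_eq_shift`), so
`|ε_k|, k|ε_k| ≤ 5|c′|α𝓛 = 5π|c′|𝓛⁻⁸` (`shift_corr_bounds`; `α = π𝓛⁻⁹`, `log P = 𝓛⁹`, `α log P = π`).
At the main values `ε_k = 0` the identities are exact (the tree's `Section10MainTerms.yfrak*_main_*`);
the `O(𝓛⁻⁸)` is the one-line algebra `yy_core_identity` plus the size bound `yy_err_norm_le`.
No hypothesis (A), no character, no largeness beyond `log D ≥ 1` (resp. `> 0`) is used. The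
companion `Section10TentMellin.lean` proves the Mellin–Perron displays (10.6), (10.7).

## References

* Y. Zhang, arXiv:2211.02515v1 (2022), §10, the "direct calculation" display after Lemma 10.2
  (p. 57); §2 (2.6), (2.10), (2.13). [cite: Zhang2022LandauSiegel, §10 p. 57]
-/

noncomputable section

open Complex Real

namespace Literature.NumberTheory.LFunctions.Zhang2022.Skeleton

/-! ### The parameters: `log P = 𝓛⁹`, `α log P = π`, the shifts as `ikα(1 + ε_k)` -/

/-- `P > 0`. [cite: Zhang2022LandauSiegel, §2 (2.6)] -/
private theorem bigP_pos_loc (D : ℕ) : 0 < bigP D := Real.exp_pos _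

/-- `𝓛 ≥ 0`. [cite: Zhang2022LandauSiegel, §2 (2.1)] -/
private theorem ell_nonneg (D : ℕ) : 0 ≤ ell D := Real.log_natCast_nonneg D

/-- `α = π𝓛⁻⁹` ((2.10) with (2.6)). [cite: Zhang2022LandauSiegel, §2 (2.10)] -/
private theorem alpha_eq (D : ℕ) : alpha D = π / ell D ^ 9 := by
  rw [alpha, log_bigP]

/-- `α ≥ 0`. [cite: Zhang2022LandauSiegel, §2 (2.10)] -/
private theorem alpha_nonneg (D : ℕ) : 0 ≤ alpha D := by
  rw [alpha_eq]; exact div_nonneg Real.pi_pos.le (pow_nonneg (ell_nonneg D) 9)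

/-- `α log P = π` (for `𝓛 ≠ 0`, i.e. `D ≥ 2`). [cite: Zhang2022LandauSiegel, §2 (2.10)] -/
private theorem alpha_mul_log_bigP_loc {D : ℕ} (hℓ : 0 < ell D) : alpha D * Real.log (bigP D) = π := by
  rw [alpha_eq, log_bigP]; field_simp

/-- `α𝓛 = π𝓛⁻⁸` (for `𝓛 ≠ 0`). [cite: Zhang2022LandauSiegel, §2 (2.10)] -/
private theorem alpha_mul_ell {D : ℕ} (hℓ : 0 < ell D) : alpha D * ell D = π / ell D ^ 8 := by
  rw [alpha_eq]; field_simp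

/-- `β₁ = i·1·α·(1 + ε₁)`, `ε₁ = −5c′α𝓛` (2.13). [cite: Zhang2022LandauSiegel, §2 (2.13)] -/
theorem beta1_eq_shift (c' : ℝ) (D : ℕ) : beta1 c' D =
    I * ((1 : ℕ) : ℂ) * (alpha D : ℝ) * ((1 + -(5 * c' * alpha D * ell D) : ℝ) : ℂ) := by
  rw [beta1]; push_cast; ring

/-- `β₂ = i·2·α·(1 + ε₂)`, `ε₂ = c′α𝓛` (2.13). [cite: Zhang2022LandauSiegel, §2 (2.13)] -/
theorem beta2_eq_shift (c' : ℝ) (D : ℕ) : beta2 c' D =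
    I * ((2 : ℕ) : ℂ) * (alpha D : ℝ) * ((1 + c' * alpha D * ell D : ℝ) : ℂ) := by
  rw [beta2]; push_cast; ring

/-- `β₃ = i·3·α·(1 + ε₃)`, `ε₃ = −c′α𝓛` (2.13). [cite: Zhang2022LandauSiegel, §2 (2.13)] -/
theorem beta3_eq_shift (c' : ℝ) (D : ℕ) : beta3 c' D =
    I * ((3 : ℕ) : ℂ) * (alpha D : ℝ) * ((1 + -(c' * alpha D * ell D) : ℝ) : ℂ) := by
  rw [beta3]; push_cast; ring

/-- The index convention of §8 in `betaJ`: `β₂, β₃, β₄ = β₁, β₅ = β₂`.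
[cite: Zhang2022LandauSiegel, §8 p. 17] -/
theorem betaJ_two_three_four_five (c' : ℝ) (D : ℕ) :
    betaJ c' D 2 = beta2 c' D ∧ betaJ c' D 3 = beta3 c' D ∧ betaJ c' D 4 = beta1 c' D ∧
      betaJ c' D 5 = beta2 c' D := by
  refine ⟨?_, ?_, ?_, ?_⟩ <;> simp [betaJ]

/-- The sizes of the corrections: with `η = |c′|α𝓛`, `1·|ε₁|, 2|ε₂|, 3|ε₃| ≤ 5η` and
`|ε₁|, |ε₂|, |ε₃| ≤ 5η`. [cite: Zhang2022LandauSiegel, §2 (2.13)] -/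
theorem shift_corr_bounds (c' : ℝ) (D : ℕ) :
    ((1 : ℕ) : ℝ) * |(-(5 * c' * alpha D * ell D))| ≤ 5 * (|c'| * alpha D * ell D) ∧
      ((2 : ℕ) : ℝ) * |c' * alpha D * ell D| ≤ 5 * (|c'| * alpha D * ell D) ∧
      ((3 : ℕ) : ℝ) * |(-(c' * alpha D * ell D))| ≤ 5 * (|c'| * alpha D * ell D) ∧
      |(-(5 * c' * alpha D * ell D))| ≤ 5 * (|c'| * alpha D * ell D) ∧
      |c' * alpha D * ell D| ≤ 5 * (|c'| * alpha D * ell D) ∧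
      |(-(c' * alpha D * ell D))| ≤ 5 * (|c'| * alpha D * ell D) := by
  have hα := alpha_nonneg D
  have hℓ := ell_nonneg D
  have h1 : |c' * alpha D * ell D| = |c'| * alpha D * ell D := by
    rw [abs_mul, abs_mul, abs_of_nonneg hα, abs_of_nonneg hℓ]
  have h5 : |(-(5 * c' * alpha D * ell D))| = 5 * (|c'| * alpha D * ell D) := by
    rw [abs_neg, show 5 * c' * alpha D * ell D = 5 * (c' * alpha D * ell D) by ring, abs_mul,
      abs_of_pos (by norm_num : (0:ℝ) < 5), h1]
  have h0 : 0 ≤ |c'| * alpha D * ell D := by positivity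
  rw [h5, abs_neg, h1]
  push_cast
  refine ⟨by linarith, by linarith, by linarith, le_rfl, by linarith, by linarith⟩

/-! ### `Z22:§10.u023`: `β_j log P^w = πijw + O(𝓛⁻⁸)` -/

/-- The mechanism of `Z22:§10.u023`: if `β = ibα(1 + ε)` with `b|ε| ≤ 5|c′|α𝓛`, then for every real
`w` (and `𝓛 > 0`), `‖β·log(P^w) − πibw‖ ≤ 5π²|c′||w|𝓛⁻⁸` — since `β log P = πib(1 + ε)` exactly.
[cite: Zhang2022LandauSiegel, §10 p. 57 (tex L2857)] -/
theorem norm_shift_mul_log_rpow_sub_le (c' : ℝ) {D : ℕ} (hℓ : 0 < ell D) {β : ℂ} {b : ℕ} {ε : ℝ}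
    (hβ : β = I * (b : ℂ) * (alpha D : ℝ) * ((1 + ε : ℝ) : ℂ))
    (hε : (b : ℝ) * |ε| ≤ 5 * (|c'| * alpha D * ell D)) (w : ℝ) :
    ‖β * (Real.log (bigP D ^ w) : ℂ) - π * I * b * w‖ ≤ 5 * π ^ 2 * |c'| * |w| / ell D ^ 8 := by
  have hP := bigP_pos_loc D
  have hlog : Real.log (bigP D ^ w) = w * Real.log (bigP D) := Real.log_rpow hP w
  have hαΛ : (alpha D : ℂ) * (Real.log (bigP D) : ℂ) = π := by
    exact_mod_cast alpha_mul_log_bigP_loc hℓ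
  have hdiff : β * (Real.log (bigP D ^ w) : ℂ) - π * I * b * w = π * I * b * w * (ε : ℝ) := by
    rw [hlog, hβ]
    push_cast
    linear_combination (I * b * w * (1 + ε)) * hαΛ
  rw [hdiff]
  have hnorm : ‖(π : ℂ) * I * b * w * (ε : ℝ)‖ = π * ((b : ℝ) * |ε|) * |w| := by
    rw [norm_mul, norm_mul, norm_mul, norm_mul, Complex.norm_real, Complex.norm_I,
      Complex.norm_natCast, Complex.norm_real, Complex.norm_real, Real.norm_eq_abs,
      Real.norm_eq_abs, Real.norm_eq_abs, abs_of_pos Real.pi_pos]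
    ring
  rw [hnorm]
  have hπ := Real.pi_pos
  calc π * ((b : ℝ) * |ε|) * |w| ≤ π * (5 * (|c'| * alpha D * ell D)) * |w| := by gcongr
    _ = 5 * π ^ 2 * |c'| * |w| / ell D ^ 8 := by
        rw [mul_assoc |c'|, alpha_mul_ell hℓ]
        field_simp

/-- **`Z22:§10.u023`, general exponent.** For `j ∈ {1,2,3}`, real `w` and `𝓛 > 0`:
`‖β_j·log(P^w) − πijw‖ ≤ 5π²|c′||w|𝓛⁻⁸`. [cite: Zhang2022LandauSiegel, §10 p. 57 (tex L2857)] -/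
theorem norm_betaJ_mul_log_rpow_sub_le (c' : ℝ) {D : ℕ} (hℓ : 0 < ell D) {j : ℕ}
    (hj : j ∈ ({1, 2, 3} : Finset ℕ)) (w : ℝ) :
    ‖betaJ c' D j * (Real.log (bigP D ^ w) : ℂ) - π * I * j * w‖ ≤
      5 * π ^ 2 * |c'| * |w| / ell D ^ 8 := by
  obtain ⟨b1, b2, b3, -, -, -⟩ := shift_corr_bounds c' D
  simp only [Finset.mem_insert, Finset.mem_singleton] at hj
  rcases hj with rfl | rfl | rfl
  · have h : betaJ c' D 1 = beta1 c' D := by simp [betaJ]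
    exact_mod_cast norm_shift_mul_log_rpow_sub_le c' hℓ (h.trans (beta1_eq_shift c' D)) b1 w
  · have h : betaJ c' D 2 = beta2 c' D := by simp [betaJ]
    exact_mod_cast norm_shift_mul_log_rpow_sub_le c' hℓ (h.trans (beta2_eq_shift c' D)) b2 w
  · have h : betaJ c' D 3 = beta3 c' D := by simp [betaJ]
    exact_mod_cast norm_shift_mul_log_rpow_sub_le c' hℓ (h.trans (beta3_eq_shift c' D)) b3 w

/-! ### `Z22:§10.u024`: `𝔶₁ⱼ(P^z) = 𝔶𝔶₁ⱼ(z) + O(𝓛⁻⁸)`, `𝔶₂ⱼ(P^z) = 𝔶𝔶₂ⱼ(z) + O(𝓛⁻⁸)` -/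

/-- `log(P^a/P^b) = (a − b) log P`. [folklore] -/
private theorem log_rpow_div_rpow {P : ℝ} (hP : 0 < P) (a b : ℝ) :
    Real.log (P ^ a / P ^ b) = (a - b) * Real.log P := by
  rw [Real.log_div (Real.rpow_pos_of_pos hP a).ne' (Real.rpow_pos_of_pos hP b).ne',
    Real.log_rpow hP, Real.log_rpow hP]
  ring

/-- The algebra of the "direct calculation" for `𝔶₁ⱼ`, `𝔶₂ⱼ`: with `β_k = ib_kα(1 + ε_k)`, `αΛ = π`,
`(β₁+β₂)uΛ + ½β₁β₂Λ²Q − (sπiu + hπ²Q)` (`s = b₁ + b₂`, `h = −b₁b₂/2`) equals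
`iπ(b₁ε₁ + b₂ε₂)u − ½b₁b₂π²(ε₁ + ε₂ + ε₁ε₂)Q`. [cite: Zhang2022LandauSiegel, §10 p. 57 (tex L2860)] -/
theorem yy_core_identity {α Λ : ℂ} (h : α * Λ = π) (b₁ b₂ ε₁ ε₂ u Q : ℂ) :
    (I * b₁ * α * (1 + ε₁) + I * b₂ * α * (1 + ε₂)) * (u * Λ) +
        I * b₁ * α * (1 + ε₁) * (I * b₂ * α * (1 + ε₂)) / 2 * (Λ ^ 2 * Q) -
      ((b₁ + b₂) * π * I * u + -(b₁ * b₂) / 2 * π ^ 2 * Q) =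
    I * π * (b₁ * ε₁ + b₂ * ε₂) * u - b₁ * b₂ * π ^ 2 / 2 * (ε₁ + ε₂ + ε₁ * ε₂) * Q := by
  have hI : I * I = -1 := Complex.I_mul_I
  linear_combination (I * u * (b₁ * (1 + ε₁) + b₂ * (1 + ε₂)) -
    b₁ * b₂ * (1 + ε₁) * (1 + ε₂) * Q * (α * Λ + π) / 2) * h +
    (b₁ * α * (1 + ε₁) * (b₂ * α * (1 + ε₂)) / 2 * (Λ ^ 2 * Q)) * hI

/-- The size of the "direct calculation" error: for `b₁, b₂ ≥ 0`, `b₁b₂ ≤ 6`, `b_k|ε_k| ≤ 5η`,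
`|ε_k| ≤ 5η`, `|u| ≤ 1`, `|Q| ≤ 1`:
`‖iπ(b₁ε₁ + b₂ε₂)u − ½b₁b₂π²(ε₁ + ε₂ + ε₁ε₂)Q‖ ≤ 10πη + 30π²η + 75π²η²`.
[cite: Zhang2022LandauSiegel, §10 p. 57 (tex L2860)] -/
theorem yy_err_norm_le {b₁ b₂ ε₁ ε₂ u Q η : ℝ} (hb₁ : 0 ≤ b₁) (hb₂ : 0 ≤ b₂) (hb : b₁ * b₂ ≤ 6)
    (h1 : b₁ * |ε₁| ≤ 5 * η) (h2 : b₂ * |ε₂| ≤ 5 * η) (h1' : |ε₁| ≤ 5 * η) (h2' : |ε₂| ≤ 5 * η)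
    (hu : |u| ≤ 1) (hQ : |Q| ≤ 1) :
    ‖I * π * ((b₁ * ε₁ + b₂ * ε₂ : ℝ) : ℂ) * (u : ℂ) -
        ((b₁ * b₂ * π ^ 2 / 2 * (ε₁ + ε₂ + ε₁ * ε₂) * Q : ℝ) : ℂ)‖ ≤
      10 * π * η + 30 * π ^ 2 * η + 75 * π ^ 2 * η ^ 2 := by
  have hπ := Real.pi_pos
  have hη : 0 ≤ η := by nlinarith [abs_nonneg ε₁]
  have hA : ‖I * π * ((b₁ * ε₁ + b₂ * ε₂ : ℝ) : ℂ) * (u : ℂ)‖ ≤ 10 * π * η := by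
    rw [norm_mul, norm_mul, norm_mul, Complex.norm_I, one_mul, Complex.norm_real,
      Complex.norm_real, Complex.norm_real, Real.norm_eq_abs, Real.norm_eq_abs, Real.norm_eq_abs,
      abs_of_pos hπ]
    have hs : |b₁ * ε₁ + b₂ * ε₂| ≤ 10 * η := by
      calc |b₁ * ε₁ + b₂ * ε₂| ≤ |b₁ * ε₁| + |b₂ * ε₂| := abs_add_le _ _
        _ = b₁ * |ε₁| + b₂ * |ε₂| := by
            rw [abs_mul, abs_mul, abs_of_nonneg hb₁, abs_of_nonneg hb₂]
        _ ≤ 10 * η := by linarith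
    calc π * |b₁ * ε₁ + b₂ * ε₂| * |u| ≤ π * (10 * η) * 1 := by gcongr
      _ = 10 * π * η := by ring
  have hB : ‖((b₁ * b₂ * π ^ 2 / 2 * (ε₁ + ε₂ + ε₁ * ε₂) * Q : ℝ) : ℂ)‖ ≤
      30 * π ^ 2 * η + 75 * π ^ 2 * η ^ 2 := by
    rw [Complex.norm_real, Real.norm_eq_abs, abs_mul, abs_mul,
      abs_of_nonneg (by positivity : 0 ≤ b₁ * b₂ * π ^ 2 / 2)]
    have hs : |ε₁ + ε₂ + ε₁ * ε₂| ≤ 10 * η + 25 * η ^ 2 := by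
      calc |ε₁ + ε₂ + ε₁ * ε₂| ≤ |ε₁ + ε₂| + |ε₁ * ε₂| := abs_add_le _ _
        _ ≤ |ε₁| + |ε₂| + |ε₁| * |ε₂| := by rw [abs_mul]; gcongr; exact abs_add_le _ _
        _ ≤ 5 * η + 5 * η + 5 * η * (5 * η) := by gcongr
        _ = 10 * η + 25 * η ^ 2 := by ring
    have hη2 : 0 ≤ 10 * η + 25 * η ^ 2 := by positivity
    calc b₁ * b₂ * π ^ 2 / 2 * |ε₁ + ε₂ + ε₁ * ε₂| * |Q|
        ≤ 6 * π ^ 2 / 2 * (10 * η + 25 * η ^ 2) * 1 := by gcongr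
      _ = 30 * π ^ 2 * η + 75 * π ^ 2 * η ^ 2 := by ring
  calc _ ≤ ‖I * π * ((b₁ * ε₁ + b₂ * ε₂ : ℝ) : ℂ) * (u : ℂ)‖ +
        ‖((b₁ * b₂ * π ^ 2 / 2 * (ε₁ + ε₂ + ε₁ * ε₂) * Q : ℝ) : ℂ)‖ := norm_sub_le _ _
    _ ≤ _ := by linarith

/-- `10πη + 30π²η + 75π²η² ≤ (10π²|c′| + 30π³|c′| + 75π⁴c′²)𝓛⁻⁸` for `η = |c′|α𝓛 = π|c′|𝓛⁻⁸`,
`𝓛 ≥ 1`. [cite: Zhang2022LandauSiegel, §10 p. 57 (tex L2860)] -/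
private theorem yy_err_le (c' : ℝ) {D : ℕ} (hℓ : 1 ≤ ell D) :
    10 * π * (|c'| * alpha D * ell D) + 30 * π ^ 2 * (|c'| * alpha D * ell D) +
        75 * π ^ 2 * (|c'| * alpha D * ell D) ^ 2 ≤
      (10 * π ^ 2 * |c'| + 30 * π ^ 3 * |c'| + 75 * π ^ 4 * c' ^ 2) / ell D ^ 8 := by
  have hℓ0 : 0 < ell D := by linarith
  have hη : |c'| * alpha D * ell D = π * |c'| / ell D ^ 8 := by
    rw [mul_assoc, alpha_mul_ell hℓ0]; ring
  rw [hη]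
  have hπ := Real.pi_pos
  have hℓ8 : 0 < ell D ^ 8 := pow_pos hℓ0 8
  have hsq : (π * |c'| / ell D ^ 8) ^ 2 ≤ π ^ 2 * c' ^ 2 / ell D ^ 8 := by
    rw [div_pow, mul_pow, sq_abs, div_le_div_iff₀ (by positivity) hℓ8]
    calc π ^ 2 * c' ^ 2 * ell D ^ 8 = π ^ 2 * c' ^ 2 * (ell D ^ 8 * 1) := by ring
      _ ≤ π ^ 2 * c' ^ 2 * (ell D ^ 8 * ell D ^ 8) := by gcongr; exact one_le_pow₀ hℓ
      _ = π ^ 2 * c' ^ 2 * (ell D ^ 8) ^ 2 := by ring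
  calc 10 * π * (π * |c'| / ell D ^ 8) + 30 * π ^ 2 * (π * |c'| / ell D ^ 8) +
        75 * π ^ 2 * (π * |c'| / ell D ^ 8) ^ 2
      ≤ 10 * π * (π * |c'| / ell D ^ 8) + 30 * π ^ 2 * (π * |c'| / ell D ^ 8) +
        75 * π ^ 2 * (π ^ 2 * c' ^ 2 / ell D ^ 8) := by gcongr
    _ = (10 * π ^ 2 * |c'| + 30 * π ^ 3 * |c'| + 75 * π ^ 4 * c' ^ 2) / ell D ^ 8 := by
        field_simp

/-- **`Z22:§10.u024`, first claim, for generic shifts.** If `β_{j+1} = ib₁α(1 + ε₁)`,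
`β_{j+2} = ib₂α(1 + ε₂)` with `b₁b₂ ≤ 6`, `b_k|ε_k| ≤ 5η`, `|ε_k| ≤ 5η`, `η = |c′|α𝓛`, then for
`0 ≤ z ≤ 1`, `𝓛 ≥ 1`: `‖𝔶₁ⱼ(P^z) − yy1F (b₁+b₂) (−b₁b₂/2) z‖ ≤ (10π²|c′| + 30π³|c′| + 75π⁴c′²)𝓛⁻⁸`.
[cite: Zhang2022LandauSiegel, §10 p. 57 (tex L2860)] -/
theorem norm_fraky1_rpow_sub_yy1F_le_of (c' : ℝ) {D : ℕ} (hℓ : 1 ≤ ell D) {j b₁ b₂ : ℕ}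
    {ε₁ ε₂ : ℝ} (h₁ : betaJ c' D (j + 1) = I * (b₁ : ℂ) * (alpha D : ℝ) * ((1 + ε₁ : ℝ) : ℂ))
    (h₂ : betaJ c' D (j + 2) = I * (b₂ : ℂ) * (alpha D : ℝ) * ((1 + ε₂ : ℝ) : ℂ))
    (hb : (b₁ : ℝ) * b₂ ≤ 6) (he₁ : (b₁ : ℝ) * |ε₁| ≤ 5 * (|c'| * alpha D * ell D))
    (he₂ : (b₂ : ℝ) * |ε₂| ≤ 5 * (|c'| * alpha D * ell D))
    (he₁' : |ε₁| ≤ 5 * (|c'| * alpha D * ell D)) (he₂' : |ε₂| ≤ 5 * (|c'| * alpha D * ell D))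
    {z : ℝ} (hz0 : 0 ≤ z) (hz1 : z ≤ 1) :
    ‖fraky1 c' D j (bigP D ^ z) - yy1F ((b₁ + b₂ : ℕ) : ℚ) (-((b₁ * b₂ : ℕ) : ℚ) / 2) z‖ ≤
      (10 * π ^ 2 * |c'| + 30 * π ^ 3 * |c'| + 75 * π ^ 4 * c' ^ 2) / ell D ^ 8 := by
  have hP := bigP_pos_loc D
  have hℓ0 : 0 < ell D := by linarith
  have hαΛ : (alpha D : ℂ) * (Real.log (bigP D) : ℂ) = π := by
    exact_mod_cast alpha_mul_log_bigP_loc hℓ0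
  have hl1 := log_rpow_div_rpow hP z 0.5
  have hl2 := log_rpow_div_rpow hP 0.504 z
  have hl3 := log_rpow_div_rpow hP 0.502 z
  have hdiff : fraky1 c' D j (bigP D ^ z) - yy1F ((b₁ + b₂ : ℕ) : ℚ) (-((b₁ * b₂ : ℕ) : ℚ) / 2) z =
      I * π * ((b₁ * ε₁ + b₂ * ε₂ : ℝ) : ℂ) * ((z - 0.5 : ℝ) : ℂ) -
        ((b₁ * b₂ * π ^ 2 / 2 * (ε₁ + ε₂ + ε₁ * ε₂) * ((0.504 - z) ^ 2 - 2 * (0.502 - z) ^ 2) : ℝ) : ℂ) := by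
    have key := yy_core_identity hαΛ (b₁ : ℂ) (b₂ : ℂ) (ε₁ : ℂ) (ε₂ : ℂ) ((z - 0.5 : ℝ) : ℂ)
      (((0.504 - z) ^ 2 - 2 * (0.502 - z) ^ 2 : ℝ) : ℂ)
    rw [fraky1, hl1, hl2, hl3, h₁, h₂, yy1F]
    push_cast at key ⊢
    linear_combination key
  rw [hdiff]
  have hu : |z - 0.5| ≤ 1 := by rw [abs_le]; constructor <;> linarith
  have hQ1 : |(0.504 - z) ^ 2 - 2 * (0.502 - z) ^ 2| ≤ 1 := by
    rw [abs_le]; constructor <;> nlinarith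
  exact (yy_err_norm_le (Nat.cast_nonneg _) (Nat.cast_nonneg _) hb he₁ he₂ he₁' he₂' hu hQ1).trans
    (yy_err_le c' hℓ)

/-- **`Z22:§10.u024`, second claim, for generic shifts**: under the same hypotheses,
`‖𝔶₂ⱼ(P^z) − yy2F (b₁+b₂) (−b₁b₂/2) z‖ ≤ (10π²|c′| + 30π³|c′| + 75π⁴c′²)𝓛⁻⁸`.
[cite: Zhang2022LandauSiegel, §10 p. 57 (tex L2860)] -/
theorem norm_fraky2_rpow_sub_yy2F_le_of (c' : ℝ) {D : ℕ} (hℓ : 1 ≤ ell D) {j b₁ b₂ : ℕ}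
    {ε₁ ε₂ : ℝ} (h₁ : betaJ c' D (j + 1) = I * (b₁ : ℂ) * (alpha D : ℝ) * ((1 + ε₁ : ℝ) : ℂ))
    (h₂ : betaJ c' D (j + 2) = I * (b₂ : ℂ) * (alpha D : ℝ) * ((1 + ε₂ : ℝ) : ℂ))
    (hb : (b₁ : ℝ) * b₂ ≤ 6) (he₁ : (b₁ : ℝ) * |ε₁| ≤ 5 * (|c'| * alpha D * ell D))
    (he₂ : (b₂ : ℝ) * |ε₂| ≤ 5 * (|c'| * alpha D * ell D))
    (he₁' : |ε₁| ≤ 5 * (|c'| * alpha D * ell D)) (he₂' : |ε₂| ≤ 5 * (|c'| * alpha D * ell D))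
    {z : ℝ} (hz0 : 0 ≤ z) (hz1 : z ≤ 1) :
    ‖fraky2 c' D j (bigP D ^ z) - yy2F ((b₁ + b₂ : ℕ) : ℚ) (-((b₁ * b₂ : ℕ) : ℚ) / 2) z‖ ≤
      (10 * π ^ 2 * |c'| + 30 * π ^ 3 * |c'| + 75 * π ^ 4 * c' ^ 2) / ell D ^ 8 := by
  have hP := bigP_pos_loc D
  have hℓ0 : 0 < ell D := by linarith
  have hαΛ : (alpha D : ℂ) * (Real.log (bigP D) : ℂ) = π := by
    exact_mod_cast alpha_mul_log_bigP_loc hℓ0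
  have hl2 := log_rpow_div_rpow hP 0.504 z
  have hdiff : fraky2 c' D j (bigP D ^ z) - yy2F ((b₁ + b₂ : ℕ) : ℚ) (-((b₁ * b₂ : ℕ) : ℚ) / 2) z =
      I * π * ((b₁ * ε₁ + b₂ * ε₂ : ℝ) : ℂ) * ((0.504 - z : ℝ) : ℂ) -
        ((b₁ * b₂ * π ^ 2 / 2 * (ε₁ + ε₂ + ε₁ * ε₂) * ((0.504 - z) ^ 2) : ℝ) : ℂ) := by
    have key := yy_core_identity hαΛ (b₁ : ℂ) (b₂ : ℂ) (ε₁ : ℂ) (ε₂ : ℂ) ((0.504 - z : ℝ) : ℂ)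
      (((0.504 - z) ^ 2 : ℝ) : ℂ)
    rw [fraky2, hl2, h₁, h₂, yy2F]
    push_cast at key ⊢
    linear_combination key
  rw [hdiff]
  have hu : |(0.504 : ℝ) - z| ≤ 1 := by rw [abs_le]; constructor <;> linarith
  have hQ1 : |((0.504 : ℝ) - z) ^ 2| ≤ 1 := by rw [abs_le]; constructor <;> nlinarith
  exact (yy_err_norm_le (Nat.cast_nonneg _) (Nat.cast_nonneg _) hb he₁ he₂ he₁' he₂' hu hQ1).trans
    (yy_err_le c' hℓ)

end Literature.NumberTheory.LFunctions.Zhang2022.Skeleton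

namespace Literature.NumberTheory.LFunctions.Zhang2022.Typed.Sec10A

open Literature.NumberTheory.LFunctions.Zhang2022.Skeleton

/-- `D ≥ 3 ⇒ 𝓛 = log D ≥ 1` (`e < 3`). [folklore] -/
private theorem one_le_ell_of_three_le {D : ℕ} (hD : 3 ≤ D) : 1 ≤ ell D := by
  rw [ell, Real.le_log_iff_exp_le (by positivity)]
  have h3 : (3 : ℝ) ≤ D := by exact_mod_cast hD
  have he := Real.exp_one_lt_d9
  linarith

/-- **`Z22:§10.u023` DISCHARGED**: the typed node `Typed.Sec10A.Step10u023 c′` holds, with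
`C = 5π²|c′|` and threshold `D ≥ 3` (hypothesis (A) is not used).
[cite: Zhang2022LandauSiegel, §10 p. 56, tex L2857] -/
theorem step10u023_holds (c' : ℝ) : Step10u023 c' := by
  refine ⟨5 * π ^ 2 * |c'|, 3, fun D _ χ hD _ _ _ j hj z hz0 hz1 => ?_⟩
  have hℓ : 0 < ell D := lt_of_lt_of_le one_pos (one_le_ell_of_three_le hD)
  have key : ∀ w : ℝ, |w| ≤ 1 →
      ‖betaJ c' D j * (Real.log (bigP D ^ w) : ℂ) - π * I * j * w‖ ≤ 5 * π ^ 2 * |c'| * (ell D ^ 8)⁻¹ :=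
    fun w hw => calc
      _ ≤ 5 * π ^ 2 * |c'| * |w| / ell D ^ 8 := norm_betaJ_mul_log_rpow_sub_le c' hℓ hj w
      _ ≤ 5 * π ^ 2 * |c'| * 1 / ell D ^ 8 := by gcongr
      _ = _ := by rw [mul_one, div_eq_mul_inv]
  exact ⟨key (z - 0.5) (by rw [abs_le]; constructor <;> linarith),
    key (0.504 - z) (by rw [abs_le]; constructor <;> linarith)⟩

variable (c' : ℝ) in
/-- `Step10u023` — `_holds` alias of `step10u023_holds` above under the fact's exact name, stated under the
prover's own binders as section variables (appended 2026-08-28, D-0026 bookkeeping: the proof term is the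
existing theorem of this file; no statement, definition or attribute is edited; no new named fact; the
ledger's debt table listed the fact unproved). [cite: Zhang2022LandauSiegel, §10 p. 56, tex L2857] -/
theorem _root_.Literature.NumberTheory.LFunctions.Zhang2022.Typed.Sec10A.Step10u023_holds :
    _root_.Literature.NumberTheory.LFunctions.Zhang2022.Typed.Sec10A.Step10u023 c' :=
  _root_.Literature.NumberTheory.LFunctions.Zhang2022.Typed.Sec10A.step10u023_holds (c' := c')

/-- **`Z22:§10.u024` DISCHARGED**: the typed node `Typed.Sec10A.Step10u024 c′` holds (the six printed
`𝔶𝔶_{μj}` = the tree's `yy11 … yy23` = `Z22:§10.u025`–`u030`), with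
`C = 10π²|c′| + 30π³|c′| + 75π⁴c′²` and threshold `D ≥ 3` (hypothesis (A) is not used).
[cite: Zhang2022LandauSiegel, §10 p. 56, tex L2860–2881] -/
theorem step10u024_holds (c' : ℝ) : Step10u024 c' := by
  refine ⟨10 * π ^ 2 * |c'| + 30 * π ^ 3 * |c'| + 75 * π ^ 4 * c' ^ 2, 3,
    fun D _ χ hD _ _ _ j hj z hz0 hz1 => ?_⟩
  have hℓ : 1 ≤ ell D := one_le_ell_of_three_le hD
  obtain ⟨b1, b2, b3, b1', b2', b3'⟩ := shift_corr_bounds c' D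
  obtain ⟨hJ2, hJ3, hJ4, hJ5⟩ := betaJ_two_three_four_five c' D
  have e2 := hJ2.trans (beta2_eq_shift c' D)
  have e3 := hJ3.trans (beta3_eq_shift c' D)
  have e4 := hJ4.trans (beta1_eq_shift c' D)
  have e5 := hJ5.trans (beta2_eq_shift c' D)
  -- the printed polynomials are `yy1F/yy2F (b₁+b₂) (−b₁b₂/2)` for `(b₁,b₂) = (2,3), (3,1), (1,2)`
  have n11 : yy11 = yy1F ((2 + 3 : ℕ) : ℚ) (-((2 * 3 : ℕ) : ℚ) / 2) := by rw [yy11]; norm_num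
  have n21 : yy21 = yy2F ((2 + 3 : ℕ) : ℚ) (-((2 * 3 : ℕ) : ℚ) / 2) := by rw [yy21]; norm_num
  have n12 : yy12 = yy1F ((3 + 1 : ℕ) : ℚ) (-((3 * 1 : ℕ) : ℚ) / 2) := by rw [yy12]; norm_num
  have n22 : yy22 = yy2F ((3 + 1 : ℕ) : ℚ) (-((3 * 1 : ℕ) : ℚ) / 2) := by rw [yy22]; norm_num
  have n13 : yy13 = yy1F ((1 + 2 : ℕ) : ℚ) (-((1 * 2 : ℕ) : ℚ) / 2) := by rw [yy13]; norm_num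
  have n23 : yy23 = yy2F ((1 + 2 : ℕ) : ℚ) (-((1 * 2 : ℕ) : ℚ) / 2) := by rw [yy23]; norm_num
  rw [← div_eq_mul_inv]
  simp only [Finset.mem_insert, Finset.mem_singleton] at hj
  rcases hj with rfl | rfl | rfl
  · rw [if_pos rfl, if_pos rfl, n11, n21]
    exact ⟨norm_fraky1_rpow_sub_yy1F_le_of c' hℓ e2 e3 (by norm_num) b2 b3 b2' b3' hz0 hz1,
      norm_fraky2_rpow_sub_yy2F_le_of c' hℓ e2 e3 (by norm_num) b2 b3 b2' b3' hz0 hz1⟩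
  · rw [if_neg (by norm_num), if_pos rfl, if_neg (by norm_num), if_pos rfl, n12, n22]
    exact ⟨norm_fraky1_rpow_sub_yy1F_le_of c' hℓ e3 e4 (by norm_num) b3 b1 b3' b1' hz0 hz1,
      norm_fraky2_rpow_sub_yy2F_le_of c' hℓ e3 e4 (by norm_num) b3 b1 b3' b1' hz0 hz1⟩
  · rw [if_neg (by norm_num), if_neg (by norm_num), if_neg (by norm_num), if_neg (by norm_num),
      n13, n23]
    exact ⟨norm_fraky1_rpow_sub_yy1F_le_of c' hℓ e4 e5 (by norm_num) b1 b2 b1' b2' hz0 hz1,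
      norm_fraky2_rpow_sub_yy2F_le_of c' hℓ e4 e5 (by norm_num) b1 b2 b1' b2' hz0 hz1⟩

variable (c' : ℝ) in
/-- `Step10u024` — `_holds` alias of `step10u024_holds` above under the fact's exact name, stated under the
prover's own binders as section variables (appended 2026-08-28, D-0026 bookkeeping: the proof term is the
existing theorem of this file; no statement, definition or attribute is edited; no new named fact; the
ledger's debt table listed the fact unproved). [cite: Zhang2022LandauSiegel, §10 p. 56, tex L2860–2881] -/
theorem _root_.Literature.NumberTheory.LFunctions.Zhang2022.Typed.Sec10A.Step10u024_holds :
    _root_.Literature.NumberTheory.LFunctions.Zhang2022.Typed.Sec10A.Step10u024 c' :=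
  _root_.Literature.NumberTheory.LFunctions.Zhang2022.Typed.Sec10A.step10u024_holds (c' := c')

end Literature.NumberTheory.LFunctions.Zhang2022.Typed.Sec10A
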